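import Summits.BirchSwinnertonDyer.BirchSwinnertonDyer.Theorems.ByReductionTypeAtTwoOrdKatoHalfAtTwoIsoPosDiscEpsilonDefs
import Summits.BirchSwinnertonDyer.BirchSwinnertonDyer.Theorems.ByReductionTypeAtTwoOrdKatoHalfAtTwoIsoPosDiscSplit
import Summits.BirchSwinnertonDyer.BirchSwinnertonDyer.Theorems.ByReductionTypeAtTwoOrdKatoHalfAtTwoIsoColemanHalfClassSemilinear
import Summits.BirchSwinnertonDyer.BirchSwinnertonDyer.Theorems.ByReductionTypeAtTwoAdditiveKatoFineDivisionFieldFourI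
import HarnessLib

/-!
# Route ByReductionTypeAtTwo, crux `OrdKatoHalfAtTwoIso` (stmt-BirchSwinnertonDyer-19573), child PAIR
# `OrdKatoFineZetaAtTwoResidue` (stmt-BirchSwinnertonDyer-24097), line `steinberg-fibre-at-two`: the (ε) DOOR on the cell
# [`ρ̄₂` onto ∧ `0 < Δ`] — P⁺ (span-free ι-keyed Coleman `μ`-package) → Q⁺ (Coates–Sujatha (A) at `2`) → Abbes–Ullmo →
# Kato 17.4 (1)(2) ⇒ `OrdKatoHalfAtTwoIsoPosDisc`; the PAIR child and the crux BY NAME; Q⁺ from Lim@2 + Iwasawa's `μ₂ = 0`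

Seat `cruxlead-stmt-BirchSwinnertonDyer-19573-g6` (LEAD PROVER, MODE LINE; HOME `run/shared/lean/pub/bsd-2adic/`; pen RC-391 (3),
RC-400 (ii)). THEOREMS ONLY (no definition, no named fact, no `sorry`, no instance). HONEST FRAMING (cell bsd-2adic): BSD is not
proved by any of this; neither the crux `OrdKatoHalfAtTwoIso` nor the PAIR child nor the `0 < Δ` conjunct is proved here — every
door is CONDITIONAL on the displayed OPEN statements P⁺ `ColemanMuSpanFreeIotaPosDiscAtTwo` (memo), Q⁺ `FineSelmerConjATwoOrdPosDisc`
(research) / Iw⁺ `ClassicalMuTwoDivisionFieldAdjoinIOrdPosDisc` (research), the print bundle and B7′. What is UNCONDITIONAL inside: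
analytic `μ₂ = 0` for `E[2]` irreducible (p642753), INT2-AUTO, Abbes–Ullmo ⇒ `ord₂ ϖ = 0` (p654400), the span-free image-free length
bookkeeping at `(2)` with a `θ`-SEMILINEAR column map (w2 GEN 4 `…ColemanHalfClassSemilinear`, over w3 p690167), `√−1 ∈ ℚ(E[4])` and
the `2`-power index of `ℚ(E[2], i)` (addL2x).

THE (ε) ROAD (triage r1-2 GEN 33 Thm F (F4), pen RC-391): on the cell nothing Euler-systemic is load-bearing. Per datum (w2's
`mu_eq_zero_of_unitMultiple_of_exact_semilinear_of_finite_fineSelmer_pTorsion`, IN TREE): an ideal `P ⊆ Λ`, `M ⊆ P`, a `θ`-semilinear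
`τ : P → X` killing `M`, `π : X ↠ X₀` exact after `τ`, ONE element `s·G₁ ∈ M` with `s, G₁ ∉ (2)`, and `Sel₀(W/ℚ_∞)[2]` finite ⇒
`μ(X) = 0`. Per curve (§1): P⁺'s package (at `θ = ι`) for all cyclotomic data + (A) at `(W, 2)` for every cyclotomic `κ` + socket 3 ⇒
`X5.O1.KatoMuPartAtTwo W` (w2's `katoMuPartAtTwo_of_colemanPackageSemilinear_of_finite_fineSelmer_irr`); with Abbes–Ullmo and Kato
17.4 (1)(2) at `W` the integral lower divisibility AT `W` (`W′ := W`). Cell (§2): P⁺ → Q⁺ → AU → 17.4 ⇒ `OrdKatoHalfAtTwoIsoPosDisc`;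
with F1μι⁻ the PAIR child 24097 BY NAME (`Iff.rfl` on the route text); with the bundle and B7′ the crux BY NAME (lead g5's split door
p695020). Supply (§3): Q⁺ ⟸ Lim 2017 Thm. 3.5 at `2` BY NAME + Iw⁺ (tree `AddKatoTwo.conjA_two_of_classicalMu_divisionField_two_adjoin_I`,
any curve).

What this is NOT: not a proof of (A) at `2` on the cell, not a proof of the Coleman reading; no census number moves.

References: K. Kato, Astérisque 295 (2004) Thm. 12.6, (14.9.3), Thm. 16.6, Thm. 17.4, Prop. 17.11, §17.13 [Kato2004Asterisque];
J. Coates, R. Sujatha, Math. Ann. 331 (2005) Conj. A, Thm. 3.4 [CoatesSujatha2005]; M. F. Lim, Asian J. Math. 21 (2017) Thm. 3.5,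
Lemma 3.2 [Lim2017FineSelmer]; R. Greenberg, LNM 1716 (1999) §1 p. 60, Conj. 1.11 [GreenbergLNM1716]; B. Mazur, J. Tate,
J. Teitelbaum, Invent. Math. 84 (1986) §I.12 [MazurTateTeitelbaum1986Invent]; A. Abbes, E. Ullmo, Compositio 103 (1996) Thm. A
[AbbesUllmo1996]; tree p642753, p654400, w2 GEN 4 `…ColemanHalfClassSemilinear`, p693557/p695020 (lead g5), p699544 (lead g6 texts),
addL2x `…AdditiveKatoFineDivisionFieldFourI`.
-/

set_option autoImplicit false
set_option linter.dupNamespace false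

noncomputable section

open scoped Classical MatrixGroups ModularForm NumberField
open CongruenceSubgroup WeierstrassCurve Field IsDedekindDomain NumberField
open Literature.NumberTheory.GaloisRepresentations
open Literature.NumberTheory.GaloisCohomology
open Literature.NumberTheory.EllipticCurves Literature.NumberTheory.EllipticCurves.ModularForms
open Literature.NumberTheory.EllipticCurves.Kato2004
  Literature.NumberTheory.EllipticCurves.Kato2004.EulerSystemValues
open Literature.NumberTheory.EllipticCurves.Rank1Residual
open Literature.NumberTheory.EllipticCurves.Greenberg1999
open Literature.NumberTheory.IwasawaTheory
open Summit.BirchSwinnertonDyer.BirchSwinnertonDyer.Theorems.Rank1ResidualX1Defs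
  Summit.BirchSwinnertonDyer.BirchSwinnertonDyer.Rank1Residual
  Summit.BirchSwinnertonDyer.BirchSwinnertonDyer.Rank1Residual.CoreAssembly
open Summit.BirchSwinnertonDyer.Rank1Residual Summit.BirchSwinnertonDyer.Rank1Residual.X5
open Summit.BirchSwinnertonDyer.BirchSwinnertonDyer.Theorems.OrdKatoOptimalAtTwo
  Summit.BirchSwinnertonDyer.BirchSwinnertonDyer.Theorems.OrdKatoIntAtTwo
open Summit.BirchSwinnertonDyer.BirchSwinnertonDyer.Theses.ByReductionTypeAtTwo

namespace Summit.BirchSwinnertonDyer.BirchSwinnertonDyer.Theorems.SteinbergFibreAtTwo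

/-! ## §1 Per curve: Kato's `μ`-part and the integral lower divisibility AT `W` -/

/-- **Statement (A) at `(W, 2)` in the route's `∃ γ D, Module.Finite ℤ₂` currency gives «`Sel₀(W/ℚ_∞, W[2^∞])[2]` finite»**
(Pontryagin duality; tree `finite_pTorsion_of_fineSelmerDualData_moduleFinite`). [cite: GreenbergLNM1716, §1 p. 60]
[cite: CoatesSujatha2005, Conj. A and Thm. 3.4 (shape)] -/
theorem finite_fineSelmerInfty_twoTorsion_of_conjA_two (W : WeierstrassCurve ℚ) [W.IsElliptic]
    (hA : ∀ (κ : ZpExtension ℚ 2), κ.IsCyclotomic →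
      ∃ (γ : Field.absoluteGaloisGroup ℚ) (D : W.FineSelmerDualData κ γ),
        Module.Finite ℤ_[2] (RestrictScalars ℤ_[2] (IwasawaAlgebra 2) D.X))
    (κ : ZpExtension ℚ 2) (hκ : κ.IsCyclotomic) : Set.Finite {s : W.fineSelmerInfty κ | 2 • s = 0} := by
  obtain ⟨γ, D, hD⟩ := hA κ hκ
  exact IwasawaModuleFinitePadicInt.finite_pTorsion_of_fineSelmerDualData_moduleFinite W κ D hD

/-- **Kato's `μ`-part `X5.O1.KatoMuPartAtTwo W` at a curve of the cell [non-CM, analytic rank `0`, good ordinary at `2`, `ρ̄₂`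
onto, `0 < Δ`], modulo P⁺ and Q⁺ only** — w2 GEN 4's semilinear span-free `μ`-door
`katoMuPartAtTwo_of_colemanPackageSemilinear_of_finite_fineSelmer_irr` fed with P⁺'s package at `θ = ι` and (A) at `(W, 2)` from Q⁺;
`E[2]` irreducible because `ρ̄₂` is onto. No Euler system, no core Theorem A.
[cite: GreenbergLNM1716, Conj. 1.11 (p. 64) (shape)] [cite: Kato2004Asterisque, §17.13 (pp. 279–280)] -/
theorem katoMuPartAtTwo_of_epsilon (hP : ColemanMuSpanFreeIotaPosDiscAtTwo) (hQ : FineSelmerConjATwoOrdPosDisc)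
    (W : WeierstrassCurve ℚ) [W.IsElliptic] [W.IsGloballyMinimal] (hcm : ¬ W.HasCM) (hr : W.analyticRank = 0)
    (hgo : GoodOrd W 2) (h2 : W.HasSurjectiveModNGaloisRep 2) (hΔ : 0 < W.Δ) : O1.KatoMuPartAtTwo W := by
  haveI : NeZero ((2 : ℕ) : ℚ) := ⟨by norm_num⟩
  refine katoMuPartAtTwo_of_colemanPackageSemilinear_of_finite_fineSelmer_irr W
    (hasIrreducibleModPGaloisRep_of_hasSurjectiveModNGaloisRep W 2 h2) (fun f κ γ hκ hγ hγ' hf D Y ↦ ?_)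
    (finite_fineSelmerInfty_twoTorsion_of_conjA_two W (hQ W hcm hr hgo h2 hΔ))
  obtain ⟨P, M, τ, π, h⟩ := hP W f κ γ hκ ⟨hgo.1, hgo.2⟩ h2 hΔ hγ hγ' hf D Y
  exact ⟨(IwasawaAlgebra.involEquiv 2).toRingEquiv, P, M, τ, π, h⟩

/-- **Kato's integral lower divisibility `X5.O1.MainConjectureLowerDivisibilityAtTwoOrd W` AT a curve of the cell, modulo P⁺,
Q⁺, Abbes–Ullmo BY NAME and Kato 17.4 (1)(2) at `W` (PRINT)** — `ord₂ ϖ = 0` on the good `E[2]`-irreducible locus (p654400).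
[cite: Kato2004Asterisque, Thm. 17.4 (1)(2) (p. 273)] [cite: AbbesUllmo1996, Thm. A] -/
theorem mainConjectureLowerDivisibilityAtTwoOrd_of_epsilon (hP : ColemanMuSpanFreeIotaPosDiscAtTwo)
    (hQ : FineSelmerConjATwoOrdPosDisc) (hAU : abbesUllmo_not_dvd_maninConstant_of_not_dvd_level)
    (W : WeierstrassCurve ℚ) [W.IsElliptic] [W.IsGloballyMinimal] (hcm : ¬ W.HasCM) (hr : W.analyticRank = 0)
    (hgo : GoodOrd W 2) (h2 : W.HasSurjectiveModNGaloisRep 2) (hΔ : 0 < W.Δ)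
    (h17 : ∀ [NeZero (W.conductorNorm ℤ)] (f : CuspForm (Gamma0 (W.conductorNorm ℤ)) 2),
      kato_divisibility_allPrimes W 2 (f := f)) :
    O1.MainConjectureLowerDivisibilityAtTwoOrd W := by
  haveI : NeZero ((2 : ℕ) : ℚ) := ⟨by norm_num⟩
  exact O1.mainConjectureLowerDivisibilityAtTwoOrd_of_katoMuPartAtTwo W h17
    (fun f hf ϖ hϖ => hint_two_of_abbesUllmo_of_irr hAU W hgo
      (hasIrreducibleModPGaloisRep_of_hasSurjectiveModNGaloisRep W 2 h2) f hf ϖ hϖ)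
    (katoMuPartAtTwo_of_epsilon hP hQ W hcm hr hgo h2 hΔ)

/-! ## §2 The cell, the PAIR child and the crux BY NAME -/

/-- **(ε) DOOR: the `0 < Δ` conjunct `OrdKatoHalfAtTwoIsoPosDisc` BY NAME from P⁺, Q⁺, Abbes–Ullmo and Kato 17.4 (1)(2) at `2`**
(`W′ := W`). CONDITIONAL on the displayed OPEN statements; nothing closed.
[cite: Kato2004Asterisque, Thm. 17.4 (1)(2) (p. 273)] [cite: AbbesUllmo1996, Thm. A] [cite: CoatesSujatha2005, Conj. A (shape)] -/
theorem ordKatoHalfAtTwoIsoPosDisc_of_epsilon (hP : ColemanMuSpanFreeIotaPosDiscAtTwo)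
    (hQ : FineSelmerConjATwoOrdPosDisc) (hAU : abbesUllmo_not_dvd_maninConstant_of_not_dvd_level)
    (h17 : ∀ (V : WeierstrassCurve ℚ) [V.IsElliptic] [V.IsGloballyMinimal] [NeZero (V.conductorNorm ℤ)]
      (f : CuspForm (Gamma0 (V.conductorNorm ℤ)) 2), kato_divisibility_allPrimes V 2 (f := f)) :
    OrdKatoHalfAtTwoIsoPosDisc :=
  fun W _ _ hcm hr hgo h2 hΔ =>
    ⟨W, ‹_›, ‹_›, isIsogenous_self W,
      mainConjectureLowerDivisibilityAtTwoOrd_of_epsilon hP hQ hAU W hcm hr hgo h2 hΔ (h17 W)⟩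

/-- **The (ε) door with the print tier taken from the bundle** (child 23889: PUB ∧ Abbes–Ullmo ∧ Greenberg 5.14@2; Kato
17.4 (1)(2) at `2` is PUB's third conjunct). [cite: Kato2004Asterisque, Thm. 17.4 (1)(2) (p. 273)] [cite: AbbesUllmo1996, Thm. A] -/
theorem ordKatoHalfAtTwoIsoPosDisc_of_epsilon_bundle (hP : ColemanMuSpanFreeIotaPosDiscAtTwo)
    (hQ : FineSelmerConjATwoOrdPosDisc)
    (hbundle : OrdPublishedInputsAtTwo ∧ abbesUllmo_not_dvd_maninConstant_of_not_dvd_level ∧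
      Greenberg1999.prop514_isTorsion_mu_eq_zero_two) : OrdKatoHalfAtTwoIsoPosDisc := by
  obtain ⟨hPub, hAU, -⟩ := hbundle
  obtain ⟨_, _, h17, _⟩ := hPub
  exact ordKatoHalfAtTwoIsoPosDisc_of_epsilon hP hQ hAU h17

/-- **The PAIR child `OrdKatoFineZetaAtTwoResidue` (stmt-BirchSwinnertonDyer-24097, K4 rev 41) unfolds to F1μι⁻ ∧ the `0 < Δ`
conjunct** — its text is VERBATIM the two bodies (pen `plan/p8-pair/CertP8Glue.lean`). [folklore] -/
theorem ordKatoFineZetaAtTwoResidue_iff_halves :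
    OrdKatoFineZetaAtTwoResidue ↔ ZetaColemanMuIotaNegDiscAtTwo ∧ OrdKatoHalfAtTwoIsoPosDisc :=
  Iff.rfl

/-- **The PAIR child BY NAME from its two halves.** [folklore] -/
theorem ordKatoFineZetaAtTwoResidue_of_halves (hNeg : ZetaColemanMuIotaNegDiscAtTwo) (hPos : OrdKatoHalfAtTwoIsoPosDisc) :
    OrdKatoFineZetaAtTwoResidue :=
  ordKatoFineZetaAtTwoResidue_iff_halves.mpr ⟨hNeg, hPos⟩

/-- **The PAIR child `OrdKatoFineZetaAtTwoResidue` (stmt-BirchSwinnertonDyer-24097) BY NAME from F1μι⁻ (conjunct 1 verbatim), P⁺,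
Q⁺, Abbes–Ullmo and Kato 17.4 (1)(2) at `2`.** CONDITIONAL; the item is NOT closed by this.
[cite: Kato2004Asterisque, Thm. 17.4 (1)(2) (p. 273), §17.13 (pp. 279–280)] [cite: AbbesUllmo1996, Thm. A] -/
theorem ordKatoFineZetaAtTwoResidue_of_negDisc_of_epsilon (hNeg : ZetaColemanMuIotaNegDiscAtTwo)
    (hP : ColemanMuSpanFreeIotaPosDiscAtTwo) (hQ : FineSelmerConjATwoOrdPosDisc)
    (hAU : abbesUllmo_not_dvd_maninConstant_of_not_dvd_level)
    (h17 : ∀ (V : WeierstrassCurve ℚ) [V.IsElliptic] [V.IsGloballyMinimal] [NeZero (V.conductorNorm ℤ)]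
      (f : CuspForm (Gamma0 (V.conductorNorm ℤ)) 2), kato_divisibility_allPrimes V 2 (f := f)) :
    OrdKatoFineZetaAtTwoResidue :=
  ordKatoFineZetaAtTwoResidue_of_halves hNeg (ordKatoHalfAtTwoIsoPosDisc_of_epsilon hP hQ hAU h17)

/-- **The crux `OrdKatoHalfAtTwoIso` BY NAME from F1μι⁻, P⁺, Q⁺, the print bundle (child 23889) and B7′ (child 23921)** — the
lead g5 split door `ordKatoHalfAtTwoIso_of_iota_halves` (p695020) with its `0 < Δ` input supplied by the (ε) door. CONDITIONAL on
the displayed OPEN statements; nothing closed. [cite: Kato2004Asterisque, Thm. 17.4 (1)(2) (p. 273)]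
[cite: GreenbergLNM1716, Prop. 5.14 (p. 130)] [cite: AbbesUllmo1996, Thm. A] -/
theorem ordKatoHalfAtTwoIso_of_negDisc_of_epsilon (hNeg : ZetaColemanMuIotaNegDiscAtTwo)
    (hP : ColemanMuSpanFreeIotaPosDiscAtTwo) (hQ : FineSelmerConjATwoOrdPosDisc)
    (hbundle : OrdPublishedInputsAtTwo ∧ abbesUllmo_not_dvd_maninConstant_of_not_dvd_level ∧
      Greenberg1999.prop514_isTorsion_mu_eq_zero_two)
    (hB7' : KatoMuPartOff514AtOptimalMemberOfNotSurjectiveTwo) : OrdKatoHalfAtTwoIso :=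
  ordKatoHalfAtTwoIso_of_iota_halves hNeg (ordKatoHalfAtTwoIsoPosDisc_of_epsilon_bundle hP hQ hbundle) hbundle hB7'

/-! ## §3 Supply of Q⁺: Lim 2017 Thm. 3.5 at `2` BY NAME + Iwasawa's `μ₂ = 0` for `ℚ(E[2], √−1)` -/

/-- **Q⁺ from Lim 2017 Thm. 3.5 at `p = 2` (named fact, PRINT) and Iw⁺** — for each curve of the cell pick `i ∈ ℚ(W[4])` with
`i² = −1` (`AddKatoTwo.exists_sq_eq_neg_one_mem_divisionField_four`) and run the tree door
`AddKatoTwo.conjA_two_of_classicalMu_divisionField_two_adjoin_I` on the honest carrier `ℚ(W[2], i) ≤ ℚ(W[4])`. CONDITIONAL on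
`hLim2` (print) and `hIw` (open conjecture); nothing asserted. [cite: Lim2017FineSelmer, §3 Thm. 3.5 and Lemma 3.2]
[cite: CoatesSujatha2005, Conj. A and Thm. 3.4] [cite: Iwasawa1973MuInvariants, §1 (shape)] -/
theorem fineSelmerConjATwoOrdPosDisc_of_lim_of_classicalMu
    (hLim2 : Lim2017.thm35_at_two_fineSelmerDual_moduleFinite_of_classicalMuVanishes_of_le_divisionField_four)
    (hIw : ClassicalMuTwoDivisionFieldAdjoinIOrdPosDisc) : FineSelmerConjATwoOrdPosDisc := by
  intro W _ _ hcm hr hgo h2 hΔ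
  obtain ⟨i, hi, -⟩ := AddKatoTwo.exists_sq_eq_neg_one_mem_divisionField_four W two_ne_zero
  exact AddKatoTwo.conjA_two_of_classicalMu_divisionField_two_adjoin_I hLim2 W hi (hIw W hcm hr hgo h2 hΔ i hi)

/-- **The `0 < Δ` conjunct BY NAME from P⁺ (memo), Iw⁺ (Iwasawa's `μ₂ = 0` for `ℚ(E[2], √−1)` on the cell) and THREE PRINT facts
by name: Lim 2017 Thm. 3.5 at `2`, Abbes–Ullmo, Kato 17.4 (1)(2) at `2`.** CONDITIONAL; nothing closed.
[cite: Lim2017FineSelmer, §3 Thm. 3.5 and Lemma 3.2] [cite: Kato2004Asterisque, Thm. 17.4 (1)(2) (p. 273)] [cite: AbbesUllmo1996, Thm. A] -/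
theorem ordKatoHalfAtTwoIsoPosDisc_of_colemanMu_of_lim_of_classicalMu (hP : ColemanMuSpanFreeIotaPosDiscAtTwo)
    (hLim2 : Lim2017.thm35_at_two_fineSelmerDual_moduleFinite_of_classicalMuVanishes_of_le_divisionField_four)
    (hIw : ClassicalMuTwoDivisionFieldAdjoinIOrdPosDisc) (hAU : abbesUllmo_not_dvd_maninConstant_of_not_dvd_level)
    (h17 : ∀ (V : WeierstrassCurve ℚ) [V.IsElliptic] [V.IsGloballyMinimal] [NeZero (V.conductorNorm ℤ)]
      (f : CuspForm (Gamma0 (V.conductorNorm ℤ)) 2), kato_divisibility_allPrimes V 2 (f := f)) :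
    OrdKatoHalfAtTwoIsoPosDisc :=
  ordKatoHalfAtTwoIsoPosDisc_of_epsilon hP (fineSelmerConjATwoOrdPosDisc_of_lim_of_classicalMu hLim2 hIw) hAU h17

/-- **The crux `OrdKatoHalfAtTwoIso` BY NAME in the finest (ε) currency**: F1μι⁻ (memo, `Δ < 0`), P⁺ (memo, `0 < Δ`), Iw⁺
(Iwasawa's `μ₂ = 0` for `ℚ(E[2], √−1)` on the cell), B7′ (memo, `ρ̄₂` not onto), and PRINT by name: the bundle (PUB ∧ Abbes–Ullmo
∧ Greenberg 5.14@2) and Lim 2017 Thm. 3.5 at `2`. CONDITIONAL; nothing closed. [cite: Kato2004Asterisque, Thm. 17.4 (1)(2) (p. 273)]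
[cite: Lim2017FineSelmer, §3 Thm. 3.5 and Lemma 3.2] [cite: GreenbergLNM1716, Prop. 5.14 (p. 130)] -/
theorem ordKatoHalfAtTwoIso_of_negDisc_of_colemanMu_of_lim_of_classicalMu (hNeg : ZetaColemanMuIotaNegDiscAtTwo)
    (hP : ColemanMuSpanFreeIotaPosDiscAtTwo)
    (hLim2 : Lim2017.thm35_at_two_fineSelmerDual_moduleFinite_of_classicalMuVanishes_of_le_divisionField_four)
    (hIw : ClassicalMuTwoDivisionFieldAdjoinIOrdPosDisc)
    (hbundle : OrdPublishedInputsAtTwo ∧ abbesUllmo_not_dvd_maninConstant_of_not_dvd_level ∧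
      Greenberg1999.prop514_isTorsion_mu_eq_zero_two)
    (hB7' : KatoMuPartOff514AtOptimalMemberOfNotSurjectiveTwo) : OrdKatoHalfAtTwoIso :=
  ordKatoHalfAtTwoIso_of_negDisc_of_epsilon hNeg hP (fineSelmerConjATwoOrdPosDisc_of_lim_of_classicalMu hLim2 hIw)
    hbundle hB7'

end Summit.BirchSwinnertonDyer.BirchSwinnertonDyer.Theorems.SteinbergFibreAtTwo

end
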